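import Summits.Ventures.PercRepro2.CaseOnePocketForms
import Summits.Ventures.PercRepro2.CaseOneMovesAnchors

/-!
# The pocket step as a move
(blind cell PercRepro2, p1 g27; `CaseOneMoves` extended by the pocket reduction)

`MoveStepP` is `MoveStep` (the thickenings with the statement vertex fixed, and the pendant step) with
one more step, `MoveStepP.pocket`: the statement vertex moves from the cut vertex `x` of a mark-free
pocket, in the contracted graph, to a vertex `a₃` of the pocket in the original graph. `MovesP` is the
reflexive–transitive closure; **`closedAt_of_movesP`**: the closed property at the start of a sequence of
such moves gives it at the end (`closedAt_of_moves` + `closedAt_of_pocket`), and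
`closedAt_of_movesP_closedAnchor` starts the sequence at a closed anchor. The corollary
`closedAt_of_pocket_at_mark`: a statement vertex in a mark-free pocket whose cut vertex is a mark is
closed unconditionally (K7 for the pocket at the root `a₁`). Own code; standard axioms. -/

namespace Summit.Ventures.PercRepro2

namespace CaseOne

universe u

section MovesP
variable {V : Type*}

/-- **One move with pockets**: a `MoveStep`, or the pocket step from the cut vertex `x` of a mark-free
pocket (in the contracted graph) to a vertex `a₃` of the pocket (in the original graph). -/
inductive MoveStepP (o a₁ a₂ b : V) :
    (E' : Type u) → [Fintype E'] → [DecidableEq E'] → (E' → Sym2 V) → V →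
      (E : Type u) → [Fintype E] → [DecidableEq E] → (E → Sym2 V) → V → Prop
  /-- a thickening or a pendant step -/
  | move {E' : Type u} [Fintype E'] [DecidableEq E'] {ends' : E' → Sym2 V} {v' : V} {E : Type u}
      [Fintype E] [DecidableEq E] {ends : E → Sym2 V} {v : V}
      (h : MoveStep o a₁ a₂ b E' ends' v' E ends v) : MoveStepP o a₁ a₂ b E' ends' v' E ends v
  /-- the pocket step: from `x` in the contracted graph to `a₃ ∈ W` in `G` -/
  | pocket (E : Type u) [Fintype E] [DecidableEq E] (ends : E → Sym2 V) (W : Set V) (x : V)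
      (P : Finset E) (e₀ : E) (a₃ : V) (h : IsPocket ends W x P) (he : e₀ ∈ P) (ha : a₃ ∈ W)
      (ho : o ∉ W) (h1 : a₁ ∉ W) (h2 : a₂ ∉ W) (hb : b ∉ W) :
      MoveStepP o a₁ a₂ b E (pocketEnds ends P e₀ a₃ x) x E ends a₃

/-- **Moves with pockets**: finitely many `MoveStepP`s. -/
inductive MovesP (o a₁ a₂ b : V) :
    (E' : Type u) → [Fintype E'] → [DecidableEq E'] → (E' → Sym2 V) → V →
      (E : Type u) → [Fintype E] → [DecidableEq E] → (E → Sym2 V) → V → Prop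
  /-- no move -/
  | refl (E : Type u) [Fintype E] [DecidableEq E] (ends : E → Sym2 V) (v : V) :
      MovesP o a₁ a₂ b E ends v E ends v
  /-- one more move -/
  | tail {E' : Type u} [Fintype E'] [DecidableEq E'] {ends' : E' → Sym2 V} {v' : V} {Em : Type u}
      [Fintype Em] [DecidableEq Em] {endsm : Em → Sym2 V} {vm : V} {E : Type u} [Fintype E]
      [DecidableEq E] {ends : E → Sym2 V} {v : V} (h : MovesP o a₁ a₂ b E' ends' v' Em endsm vm)
      (hstep : MoveStepP o a₁ a₂ b Em endsm vm E ends v) : MovesP o a₁ a₂ b E' ends' v' E ends v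

variable {R : Type*} [CommRing R] [LinearOrder R] [IsStrictOrderedRing R] {o a₁ a₂ b : V}

/-- One move with pockets preserves the closed property. -/
theorem closedAt_of_moveStepP {E' : Type u} [Fintype E'] [DecidableEq E'] {ends' : E' → Sym2 V}
    {v' : V} {E : Type u} [Fintype E] [DecidableEq E] {ends : E → Sym2 V} {v : V}
    (h : MoveStepP o a₁ a₂ b E' ends' v' E ends v) (hc : ClosedAt R o a₁ a₂ b E' ends' v') :
    ClosedAt R o a₁ a₂ b E ends v := by
  cases h with
  | move h => exact closedAt_of_moveStep h hc
  | pocket =>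
    exact closedAt_of_pocket (by assumption) (by assumption) (by assumption) (by assumption)
      (by assumption) (by assumption) (by assumption) hc

/-- **The closed property is preserved by every sequence of moves with pockets.** -/
theorem closedAt_of_movesP {E' : Type u} [Fintype E'] [DecidableEq E'] {ends' : E' → Sym2 V}
    {v' : V} {E : Type u} [Fintype E] [DecidableEq E] {ends : E → Sym2 V} {v : V}
    (h : MovesP o a₁ a₂ b E' ends' v' E ends v) (hc : ClosedAt R o a₁ a₂ b E' ends' v') :
    ClosedAt R o a₁ a₂ b E ends v := by
  induction h with
  | refl => exact hc
  | tail _ hstep ih => exact closedAt_of_moveStepP hstep ih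

/-- Every sequence of plain moves is a sequence of moves with pockets. -/
theorem MovesP.of_moves {E' : Type u} [Fintype E'] [DecidableEq E'] {ends' : E' → Sym2 V} {v' : V}
    {E : Type u} [Fintype E] [DecidableEq E] {ends : E → Sym2 V} {v : V}
    (h : Moves o a₁ a₂ b E' ends' v' E ends v) : MovesP o a₁ a₂ b E' ends' v' E ends v := by
  induction h with
  | refl => exact MovesP.refl _ _ _
  | tail _ hstep ih => exact MovesP.tail ih (MoveStepP.move hstep)

/-- The four forms for one weight vector after any sequence of moves with pockets from a closed
instance. -/
theorem fourForms_of_movesP {E' : Type u} [Fintype E'] [DecidableEq E'] {ends' : E' → Sym2 V}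
    {v' : V} {E : Type u} [Fintype E] [DecidableEq E] {ends : E → Sym2 V} {v : V}
    (h : MovesP o a₁ a₂ b E' ends' v' E ends v) (hc : ClosedAt R o a₁ a₂ b E' ends' v') (p : E → R)
    (hp : IsProbVec p) : FourForms p ends o a₁ a₂ v b :=
  closedAt_of_movesP h hc p hp

end MovesP

section Anchors
variable {V : Type*} [Fintype V] [DecidableEq V] {R : Type*} [Field R] [LinearOrder R]
  [IsStrictOrderedRing R] (o a₁ a₂ b : V)

/-- **Every instance reachable by moves with pockets from a closed anchor is closed.** -/
theorem closedAt_of_movesP_closedAnchor {E' : Type u} [Fintype E'] [DecidableEq E']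
    {ends' : E' → Sym2 V} {v' : V} (h' : ClosedAnchor o a₁ a₂ b E' ends' v') {E : Type u} [Fintype E]
    [DecidableEq E] {ends : E → Sym2 V} {v : V} (h : MovesP o a₁ a₂ b E' ends' v' E ends v) :
    ClosedAt R o a₁ a₂ b E ends v :=
  closedAt_of_movesP h (closedAt_of_closedAnchor o a₁ a₂ b E' ends' v' h')

/-- **A statement vertex in a mark-free pocket at a mark is closed** (the pocket at the root `a₁` is K7
for an arbitrary pocket in place of a pendant edge). -/
theorem closedAt_of_pocket_at_mark {E : Type u} [Fintype E] [DecidableEq E] {ends : E → Sym2 V}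
    {W : Set V} {x : V} {P : Finset E} {e₀ : E} {a₃ : V} (h : IsPocket ends W x P) (he : e₀ ∈ P)
    (ha : a₃ ∈ W) (ho : o ∉ W) (h1 : a₁ ∉ W) (h2 : a₂ ∉ W) (hb : b ∉ W)
    (hx : x = o ∨ x = a₁ ∨ x = a₂ ∨ x = b) : ClosedAt R o a₁ a₂ b E ends a₃ :=
  closedAt_of_pocket h he ha ho h1 h2 hb
    (fun p hp => fourForms_of_markAnchor o a₁ a₂ b E (pocketEnds ends P e₀ a₃ x) p hp x hx)

end Anchors

section FourFormsCons
variable {V : Type*} {R : Type*} [CommRing R] [LinearOrder R] [IsStrictOrderedRing R] {o a₁ a₂ b : V}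

/-- `(J1₁)` from the four forms (K1: `(i) ∧ (ii) ⟹ (J1₁)`). -/
theorem FourForms.jOneOne {E : Type u} [Fintype E] [DecidableEq E] {ends : E → Sym2 V} {p : E → R}
    {v : V} (h : FourForms p ends o a₁ a₂ v b) : JOneOne p ends o a₁ a₂ v b :=
  jOneOne_of_i_of_ii p ends o a₁ a₂ v b h.2.2.1 h.1

/-- `(RV)` from the four forms when `P(T′) > 0`. -/
theorem FourForms.rv {E : Type u} [Fintype E] [DecidableEq E] {ends : E → Sym2 V} {p : E → R} {v : V}
    (h : FourForms p ends o a₁ a₂ v b) (hT : 0 < prob p (Tp ends a₁ a₂ v)) : RV p ends o a₁ a₂ v b :=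
  (rv_iff_ii p ends o a₁ a₂ v b hT).2 h.1

/-- `(J1₁)` at a statement vertex in a mark-free pocket, from `ClosedAt` at the cut vertex of the
contracted graph. -/
theorem jOneOne_of_pocket {E : Type u} [Fintype E] [DecidableEq E] {ends : E → Sym2 V} {W : Set V}
    {x : V} {P : Finset E} {e₀ : E} {a₃ : V} (h : IsPocket ends W x P) (he : e₀ ∈ P) (ha : a₃ ∈ W)
    (ho : o ∉ W) (h1 : a₁ ∉ W) (h2 : a₂ ∉ W) (hb : b ∉ W)
    (hc : ClosedAt R o a₁ a₂ b E (pocketEnds ends P e₀ a₃ x) x) (p : E → R) (hp : IsProbVec p) :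
    JOneOne p ends o a₁ a₂ a₃ b :=
  FourForms.jOneOne (fourForms_of_pocket p hp h he ha ho h1 h2 hb
    (hc (pocketW p ends P e₀ a₃ x) (IsProbVec.pocketW hp ends P e₀ a₃ x)))

/-- `(RV)` at a statement vertex in a mark-free pocket, from `ClosedAt` at the cut vertex of the
contracted graph, when `P(T′) > 0`. -/
theorem rv_of_pocket {E : Type u} [Fintype E] [DecidableEq E] {ends : E → Sym2 V} {W : Set V}
    {x : V} {P : Finset E} {e₀ : E} {a₃ : V} (h : IsPocket ends W x P) (he : e₀ ∈ P) (ha : a₃ ∈ W)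
    (ho : o ∉ W) (h1 : a₁ ∉ W) (h2 : a₂ ∉ W) (hb : b ∉ W)
    (hc : ClosedAt R o a₁ a₂ b E (pocketEnds ends P e₀ a₃ x) x) (p : E → R) (hp : IsProbVec p)
    (hT : 0 < prob p (Tp ends a₁ a₂ a₃)) : RV p ends o a₁ a₂ a₃ b :=
  FourForms.rv (fourForms_of_pocket p hp h he ha ho h1 h2 hb
    (hc (pocketW p ends P e₀ a₃ x) (IsProbVec.pocketW hp ends P e₀ a₃ x))) hT

end FourFormsCons

section AnchorsCons
variable {V : Type*} [Fintype V] [DecidableEq V] {R : Type*} [Field R] [LinearOrder R]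
  [IsStrictOrderedRing R] (o a₁ a₂ b : V)

/-- `(J1₁)` on every instance reachable by moves with pockets from a closed anchor. -/
theorem jOneOne_of_movesP_closedAnchor {E' : Type u} [Fintype E'] [DecidableEq E']
    {ends' : E' → Sym2 V} {v' : V} (h' : ClosedAnchor o a₁ a₂ b E' ends' v') {E : Type u} [Fintype E]
    [DecidableEq E] {ends : E → Sym2 V} {v : V} (h : MovesP o a₁ a₂ b E' ends' v' E ends v) (p : E → R)
    (hp : IsProbVec p) : JOneOne p ends o a₁ a₂ v b :=
  FourForms.jOneOne (closedAt_of_movesP_closedAnchor o a₁ a₂ b h' h p hp)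

end AnchorsCons

end CaseOne

end Summit.Ventures.PercRepro2
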